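import Summits.ValiantsHypothesis.ValiantsHypothesis.Theorems.DefinabilityGapTranslatedSkeleton
import HarnessLib

/-!
# DefinabilityGap — singular splitting: `G_m` hits EVERY width-2 read-once chain, for every `m ≥ 3`

Route `route-ValiantsHypothesis-DefinabilityGap` (decomp-valiant cycle 1, lens 5), read-once leaf F4 / W10
(`KIPlantedHittingRO`, stmt-ValiantsHypothesis-23704), width road; `P_c = kiPer m c`, `φ = bind₁ (kiPer m)`.
LABELS: rung `w = 2` on the width road of leaf 23704 (the leaf asks width `q^b`) · 0 S-currency · closes NO item ·
decides (β″) = FULL WIDTH 2 = `RatioLeaf(m)` for EVERY `m ≥ 3` (sharp: false at `m = 2`, `DefinabilityGapWidthTwoAtTwo`) ·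
KIPlantedHitting / DcPerSuperpolynomial / VP ≠ VNP untouched.
HONESTY: black-box PIT / hitting sets for width-2 (indeed constant-width, any-order) ROABPs are CLASSICAL
([cite: SahaSaptharishiSaxena2009] and successors); what is new here is only that the planted-permanent generator `G_m`
is such a hitting generator for `m ≥ 3` — a rung in `G_m`'s own currency, not a new PIT theorem; width 3 and width
`q^b` (`b ≥ 2`, the leaf) remain OPEN: the rank-one splitting is width-2-specific (a singular `w × w` link has rank
`≤ w − 1`) and the translated-skeleton rigidity is 2-dimensional. [rung `w = 2` under leaf 23704 · 0 S-currency ·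
closes NO item]

MAIN THEOREM `kiPer_hits_widthTwo` (`m ≥ 3`): for every read-once width-2 block chain
`D = uᵀ M_1(z_{c_1}) ⋯ M_N(z_{c_N}) v` (distinct blocks, arbitrary univariate links `M_j ∈ ℂ[X]^{2×2}`, any order /
length / degree / crowding / boundary), `φ(D) = 0 ⟹ D = 0` — literally the right-hand side of
`DefinabilityGapRatioLeaf.ratioLeaf_iff`. COROLLARIES, closed BY NAME: `RatioLeaf(m)` for all `m ≥ 3`
(`ratioLeaf_of_three_le`, via `ratioLeaf_of_hits`) and full width 2 of `KIPlantedHittingRO` in its own currency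
(`kiPer_hits_isROABP_two_of_three_le`, via `kiPer_hits_isROABP_two_of_ratioLeaf`: every `N, d, π`).

PROOF = SINGULAR SPLITTING over the nonsingular theorem `kiPer_hits_widthTwo_of_det_ne_zero` of
`DefinabilityGapTranslatedSkeleton` (all links `det M_j ≢ 0`). (§1) A singular link is rank one over the PID `ℂ[X]`:
`det M = 0 ⟹ M = a bᵀ` with `a, b ∈ ℂ[X]²` (row gcd + Bézout; `M = 0` included), and every vector factors through a
NONSINGULAR diagonal link and a constant vector, `a = A·e`, `bᵀ = e'ᵀ·B` (`A = diag(a_k or 1)`, `e_k ∈ {0, 1}`; zero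
coordinates included). (§2) SPLITTING IDENTITY `uᵀ Π₁ · (A e)(e'ᵀ B)(z_c) · Π₂ v = [uᵀ Π₁ A(z_c) e] · [e'ᵀ B(z_c) Π₂ v]`:
both factors are again read-once width-2 chains with CONSTANT boundary, on sub-lists of the blocks (block `c` now
carrying the nonsingular link `A` resp. `B`). (§3) Induction on the length of a prefix allowed to contain singular
links, the suffix being nonsingular: split at the LAST singular link; `φ` is multiplicative and `ℂ[y]` a domain, so
`φ(D) = 0` kills a factor — the right factor is all-nonsingular (the translated skeleton decides it), the left factor
has a shorter singular-bearing prefix (induction); base = no singular link = the translated skeleton.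
NEWLY decided (beyond `TranslatedSkeleton` ∪ `RegularSkeleton` ∪ `AxisSubstitution`): chains WITH singular links, e.g.
`m = 3`, links `(c, [[z_c, z_c], [1, 1]])` (rank one) then `(c', diag(1, z_{c'}))`, `u = e₀`, `v = e₁`: value
`z_c · z_{c'} ≠ 0`. No placeholders. [cite: SahaSaptharishiSaxena2009, Lemma 2.1] [cite: KabanetsImpagliazzo2003, Lemma 30]
-/

noncomputable section
open MvPolynomial
open scoped Polynomial
open Literature.Computability.AlgebraicComplexity Literature.Computability.MetaComplexity
open Summit.ValiantsHypothesis.ValiantsHypothesis.Theorems.DefinabilityGapAffineRung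
open Summit.ValiantsHypothesis.ValiantsHypothesis.Theorems.DefinabilityGapZperTransfer
open Summit.ValiantsHypothesis.ValiantsHypothesis.Theorems.DefinabilityGapRatioLeaf
open Summit.ValiantsHypothesis.ValiantsHypothesis.Theorems.DefinabilityGapTranslatedSkeleton
set_option linter.dupNamespace false
namespace Summit.ValiantsHypothesis.ValiantsHypothesis.Theorems.DefinabilityGapSingularSplitting
variable {m : ℕ}

/-! ## 1. Singular links are rank one; vectors factor through nonsingular diagonal links -/

/-- A singular `2 × 2` matrix over `ℂ[X]` is a product `a bᵀ` (row gcd + Bézout; `ℂ[X]` is a PID). [folklore] -/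
theorem exists_rankOne_of_det_eq_zero (M : Matrix (Fin 2) (Fin 2) ℂ[X]) (hM : M.det = 0) :
    ∃ a b : Fin 2 → ℂ[X], ∀ i j, M i j = a i * b j := by
  classical
  rw [Matrix.det_fin_two, sub_eq_zero] at hM
  by_cases h0 : M 0 0 = 0 ∧ M 0 1 = 0
  · refine ⟨![0, 1], ![M 1 0, M 1 1], Fin.forall_fin_two.2 ⟨Fin.forall_fin_two.2 ⟨?_, ?_⟩,
      Fin.forall_fin_two.2 ⟨?_, ?_⟩⟩⟩ <;>
      simp only [Matrix.cons_val_zero, Matrix.cons_val_one, h0.1, h0.2, zero_mul, one_mul]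
  · have hbz := EuclideanDomain.gcd_eq_gcd_ab (M 0 0) (M 0 1)
    have hg : EuclideanDomain.gcd (M 0 0) (M 0 1) ≠ 0 := fun h => h0 (EuclideanDomain.gcd_eq_zero_iff.1 h)
    obtain ⟨p, hp⟩ := EuclideanDomain.gcd_dvd_left (M 0 0) (M 0 1)
    obtain ⟨q, hq⟩ := EuclideanDomain.gcd_dvd_right (M 0 0) (M 0 1)
    generalize EuclideanDomain.gcd (M 0 0) (M 0 1) = g at hbz hg hp hq
    generalize EuclideanDomain.gcdA (M 0 0) (M 0 1) = x at hbz
    generalize EuclideanDomain.gcdB (M 0 0) (M 0 1) = y at hbz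
    have hbez : p * x + q * y = 1 :=
      mul_left_cancel₀ hg (by linear_combination (-x) * hp + (-y) * hq - hbz)
    have hrs : p * M 1 1 = q * M 1 0 :=
      mul_left_cancel₀ hg (by linear_combination hM - (M 1 1) * hp + (M 1 0) * hq)
    refine ⟨![g, x * M 1 0 + y * M 1 1], ![p, q], Fin.forall_fin_two.2 ⟨Fin.forall_fin_two.2 ⟨?_, ?_⟩,
      Fin.forall_fin_two.2 ⟨?_, ?_⟩⟩⟩ <;>
      simp only [Matrix.cons_val_zero, Matrix.cons_val_one]
    · exact hp
    · exact hq
    · linear_combination (-(M 1 0)) * hbez - y * hrs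
    · linear_combination (-(M 1 1)) * hbez + x * hrs

/-- Every `a ∈ ℂ[X]²` is `A·e` with `A` a NONSINGULAR diagonal matrix and `e ∈ ℂ²` (`A_kk = a_k`, `e_k = 1`, or
`A_kk = 1`, `e_k = 0` where `a_k = 0`). [this file] -/
theorem exists_mulVec_eq (a : Fin 2 → ℂ[X]) : ∃ A : Matrix (Fin 2) (Fin 2) ℂ[X], A.det ≠ 0 ∧ ∃ e : Fin 2 → ℂ,
    ∀ i, Matrix.mulVec A (fun k => Polynomial.C (e k)) i = a i := by
  classical
  refine ⟨Matrix.diagonal fun k => if a k = 0 then 1 else a k, ?_, fun k => if a k = 0 then 0 else 1, fun i => ?_⟩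
  · rw [Matrix.det_diagonal]
    exact Finset.prod_ne_zero_iff.2 fun k _ => by split_ifs with h; exacts [one_ne_zero, h]
  · simp only [Matrix.mulVec_diagonal]
    split_ifs with h
    · rw [h, map_zero, mul_zero]
    · rw [map_one, mul_one]

/-- Row version: every `bᵀ` is `e'ᵀ·B` with `B` a nonsingular diagonal matrix and `e' ∈ ℂ²`. [this file] -/
theorem exists_vecMul_eq (b : Fin 2 → ℂ[X]) : ∃ B : Matrix (Fin 2) (Fin 2) ℂ[X], B.det ≠ 0 ∧ ∃ e : Fin 2 → ℂ,
    ∀ j, Matrix.vecMul (fun k => Polynomial.C (e k)) B j = b j := by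
  classical
  refine ⟨Matrix.diagonal fun k => if b k = 0 then 1 else b k, ?_, fun k => if b k = 0 then 0 else 1, fun j => ?_⟩
  · rw [Matrix.det_diagonal]
    exact Finset.prod_ne_zero_iff.2 fun k _ => by split_ifs with h; exacts [one_ne_zero, h]
  · simp only [Matrix.vecMul_diagonal]
    split_ifs with h
    · rw [h, map_zero, zero_mul]
    · rw [map_one, one_mul]

/-! ## 2. The splitting identity -/

/-- **SPLITTING IDENTITY**: a link `(A e)(e'ᵀ B)` at block `c` splits the chain value into the product of two read-once
width-2 chain values with constant boundary:
`uᵀ Π₁ (A e e'ᵀ B)(z_c) Π₂ v = [uᵀ Π₁ A(z_c) e] · [e'ᵀ B(z_c) Π₂ v]`. [this file] -/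
theorem chainVal_split (l₁ l₂ : List (W2Link m)) (c : Fin 3 → Fin (qOf m)) (A B M : Matrix (Fin 2) (Fin 2) ℂ[X])
    (e e' : Fin 2 → ℂ)
    (hM : ∀ i j, M i j = Matrix.mulVec A (fun k => Polynomial.C (e k)) i * Matrix.vecMul (fun k => Polynomial.C (e' k)) B j)
    (u v : Fin 2 → ℂ) :
    chainVal ((l₁ ++ (⟨c, M⟩ : W2Link m) :: l₂).map W2Link.mat) u v =
      chainVal ((l₁ ++ [(⟨c, A⟩ : W2Link m)]).map W2Link.mat) u e *
        chainVal (((⟨c, B⟩ : W2Link m) :: l₂).map W2Link.mat) e' v := by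
  simp only [chainVal, List.map_append, List.map_cons, List.map_nil, List.prod_append, List.prod_cons, List.prod_nil,
    mul_one, ← Matrix.mulVec_mulVec]
  generalize (l₁.map W2Link.mat).prod = P
  generalize Matrix.mulVec (l₂.map W2Link.mat).prod (fun k => C (v k)) = w
  simp only [Matrix.mulVec, Matrix.vecMul, dotProduct, Fin.sum_univ_two, W2Link.mat, ulink, Matrix.map_apply, hM,
    map_add, map_mul, Polynomial.aeval_C, MvPolynomial.algebraMap_eq]
  ring

/-! ## 3. The last singular link; induction over the nonsingular theorem -/

/-- A list with a singular link splits at its LAST singular link. [this file] -/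
theorem exists_last_singular : ∀ l : List (W2Link m), (∃ L ∈ l, L.M.det = 0) →
    ∃ (p : List (W2Link m)) (L : W2Link m) (s : List (W2Link m)),
      l = p ++ L :: s ∧ L.M.det = 0 ∧ ∀ L' ∈ s, L'.M.det ≠ 0
  | [], h => by obtain ⟨L, hL, -⟩ := h; simp at hL
  | L₀ :: t, h => by
    by_cases ht : ∃ L ∈ t, L.M.det = 0
    · obtain ⟨p, L, s, rfl, hL, hs⟩ := exists_last_singular t ht
      exact ⟨L₀ :: p, L, s, rfl, hL, hs⟩
    · have hs : ∀ L' ∈ t, L'.M.det ≠ 0 := fun L' hL' hd => ht ⟨L', hL', hd⟩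
      obtain ⟨L, hL, hd⟩ := h
      rcases List.mem_cons.1 hL with rfl | hmem
      · exact ⟨[], _, t, rfl, hd, hs⟩
      · exact absurd hd (hs _ hmem)

/-- INDUCTION: hitting for chains `p ++ s` whose suffix `s` is nonsingular, by induction on a bound `n ≥ |p|`; base and
right factors by `kiPer_hits_widthTwo_of_det_ne_zero`, left factor by induction (split at the last singular link).
[this file] -/
theorem hits_of_nonsingular_suffix (hm : 3 ≤ m) : ∀ (n : ℕ) (p s : List (W2Link m)), p.length ≤ n →
    (∀ L ∈ s, L.M.det ≠ 0) → ((p ++ s).map W2Link.blk).Nodup → ∀ u v : Fin 2 → ℂ,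
      bind₁ (kiPer m) (chainVal ((p ++ s).map W2Link.mat) u v) = 0 → chainVal ((p ++ s).map W2Link.mat) u v = 0 := by
  intro n
  induction n with
  | zero =>
    intro p s hp hs hnd u v h
    obtain rfl : p = [] := List.eq_nil_of_length_eq_zero (Nat.le_zero.1 hp)
    rw [List.nil_append] at hnd h ⊢
    by_contra hD
    exact kiPer_hits_widthTwo_of_det_ne_zero hm s hnd hs u v hD h
  | succ n ih =>
    intro p s hp hs hnd u v h
    by_cases hall : ∀ L ∈ p, L.M.det ≠ 0
    · by_contra hD
      exact kiPer_hits_widthTwo_of_det_ne_zero hm _ hnd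
        (fun L hL => (List.mem_append.1 hL).elim (hall L) (hs L)) u v hD h
    obtain ⟨p₁, ⟨c, M⟩, s₁, rfl, hM0, hs₁⟩ :=
      exists_last_singular p (by by_contra hne; exact hall fun L hL hd => hne ⟨L, hL, hd⟩)
    simp only [List.length_append, List.length_cons] at hp
    simp only [List.append_assoc, List.cons_append] at hnd h ⊢
    have hs' : ∀ L ∈ s₁ ++ s, L.M.det ≠ 0 := fun L hL => (List.mem_append.1 hL).elim (hs₁ L) (hs L)
    obtain ⟨a, b, hab⟩ := exists_rankOne_of_det_eq_zero M hM0
    obtain ⟨A, hA, e, he⟩ := exists_mulVec_eq a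
    obtain ⟨B, hB, e', he'⟩ := exists_vecMul_eq b
    have hMf : ∀ i j, M i j =
        Matrix.mulVec A (fun k => Polynomial.C (e k)) i * Matrix.vecMul (fun k => Polynomial.C (e' k)) B j :=
      fun i j => by rw [he, he', hab]
    rw [chainVal_split p₁ (s₁ ++ s) c A B M e e' hMf u v] at h ⊢
    rw [map_mul, mul_eq_zero] at h
    rcases h with h | h
    · have hnd₁ : ((p₁ ++ [(⟨c, A⟩ : W2Link m)]).map W2Link.blk).Nodup := by
        refine List.Nodup.sublist ?_ hnd
        simp only [List.map_append, List.map_cons, List.map_nil]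
        exact (List.singleton_sublist.2 (by simp)).append_left _
      have hA' : ∀ L ∈ [(⟨c, A⟩ : W2Link m)], L.M.det ≠ 0 := fun L hL => by
        rw [List.mem_singleton.1 hL]; exact hA
      rw [ih p₁ [(⟨c, A⟩ : W2Link m)] (by omega) hA' hnd₁ u e h, zero_mul]
    · have hnd₂ : (((⟨c, B⟩ : W2Link m) :: (s₁ ++ s)).map W2Link.blk).Nodup := by
        refine List.Nodup.sublist ?_ hnd
        simp only [List.map_append, List.map_cons]
        exact List.sublist_append_right _ _
      have hB' : ∀ L ∈ (⟨c, B⟩ : W2Link m) :: (s₁ ++ s), L.M.det ≠ 0 := fun L hL => by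
        rcases List.mem_cons.1 hL with rfl | hL'
        exacts [hB, hs' L hL']
      have hR : chainVal ((((⟨c, B⟩ : W2Link m)) :: (s₁ ++ s)).map W2Link.mat) e' v = 0 :=
        by_contra fun hne => kiPer_hits_widthTwo_of_det_ne_zero hm _ hnd₂ hB' e' v hne h
      rw [hR, mul_zero]

/-! ## 4. Full width 2 for every `m ≥ 3`, and the corollaries by name -/

/-- **FULL WIDTH-2 READ-ONCE HITTING** (`m ≥ 3`): `G_m` hits every nonzero read-once width-2 block chain — literally the
right-hand side of `ratioLeaf_iff`. Sharp: false at `m = 2`. [rung w = 2 under leaf 23704 · 0 S-currency · closes no item]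
[this file] -/
theorem kiPer_hits_widthTwo (hm : 3 ≤ m) :
    ∀ l : List (W2Link m), (l.map W2Link.blk).Nodup → ∀ u v : Fin 2 → ℂ,
      bind₁ (kiPer m) (chainVal (l.map W2Link.mat) u v) = 0 → chainVal (l.map W2Link.mat) u v = 0 := by
  intro l hl u v h
  have key := hits_of_nonsingular_suffix hm l.length l [] le_rfl (by simp) (by rwa [List.append_nil]) u v
    (by rwa [List.append_nil])
  rwa [List.append_nil] at key

/-- **`RatioLeaf(m)` HOLDS FOR EVERY `m ≥ 3`** (closed by name through `ratioLeaf_of_hits`). [this file] -/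
theorem ratioLeaf_of_three_le (hm : 3 ≤ m) :
    ∀ (c : Fin 3 → Fin (qOf m)) (rest : List (W2Link m)), (rest.map W2Link.blk).Nodup →
      c ∉ rest.map W2Link.blk → ∀ (v : Fin 2 → ℂ) (A B : ℂ[X]), IsCoprime A B → (0 < A.natDegree ∨ 0 < B.natDegree) →
      Polynomial.aeval (kiPer m c) A * bind₁ (kiPer m) (chainVal (rest.map W2Link.mat) (Pi.single 0 1) v) +
          Polynomial.aeval (kiPer m c) B * bind₁ (kiPer m) (chainVal (rest.map W2Link.mat) (Pi.single 1 1) v) = 0 →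
        bind₁ (kiPer m) (chainVal (rest.map W2Link.mat) (Pi.single 0 1) v) = 0 ∧
          bind₁ (kiPer m) (chainVal (rest.map W2Link.mat) (Pi.single 1 1) v) = 0 :=
  ratioLeaf_of_hits (kiPer_hits_widthTwo hm)

/-- **FULL WIDTH 2 OF `KIPlantedHittingRO` FOR EVERY `m ≥ 3`** (`w = 2`, every degree `d`, every variable order `π`,
every length `N`; closed by name through `kiPer_hits_isROABP_two_of_ratioLeaf`). [this file] -/
theorem kiPer_hits_isROABP_two_of_three_le (hm : 3 ≤ m) {N d : ℕ} (π : Fin N ≃ (Fin 3 → Fin (qOf m)))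
    (D : MvPolynomial (Fin 3 → Fin (qOf m)) ℂ) (hD : D ≠ 0) (hR : IsROABP ℂ 2 d π D) : bind₁ (kiPer m) D ≠ 0 :=
  kiPer_hits_isROABP_two_of_ratioLeaf (by omega) (ratioLeaf_of_three_le hm) π D hD hR

end Summit.ValiantsHypothesis.ValiantsHypothesis.Theorems.DefinabilityGapSingularSplitting
end
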